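import Literature.MathematicalPhysics.QuantumFieldTheory.BalabanImbrieJaffe1984to88.BIJ88RT53TranslCut

/-!
# `BalabanImbrieJaffe1984to88.BIJ88Eq596Display` — T. Bałaban, J. Imbrie, A. Jaffe, *Effective action and cluster properties of the
abelian Higgs model*, Commun. Math. Phys. **114** (1988) 257–315 [BalabanImbrieJaffe1988], (5.9.6) p. 297 [PDF 41] (*"Let us summarize
the operations performed so far by using the concluding formulae in the last several sections to write a complete expression for our
density"*) with (5.3.6) p. 280 [PDF 24]: **THE SHAPE OF THE DENSITY DISPLAY (5.9.6) AT MEASURE LEVEL** — its first line *"ρ^L_{k+1}(v, ψ) =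
Σ_{{X_ω}} Σ_{Λ₀^{(k)}} ∫du^{(k)}dφ^{(k)} δ_{Ax}(u^{(k)}) δ_{Λ₁^{(k)′*c}}(v/Qu^{(k)}) δ_{Λ₁^{(k)′*}}((e_k/2π)QA^{(k)}) ∫Π_{j=0}^{k−1}du^{(j)} [ … ]"* carrying
ONE integrand (the bracket of lines 2–8: characteristic functions, `Πg_k`, `Π(F + F̃)`, `ΠZ^{(j)}` and the exponential — after the scalar
field translation (5.8.1) the `ψ`-Gaussian of (5.1.1) is no longer a separate factor) which is a function of the translated gauge field
`u^{(k)}` and of the block field `v` SEPARATELY (through `f = (ie_k)⁻¹log v`, (5.3.2)–(5.3.4)), of `{u^{(j)}}`, `φ^{(k)}`, `ψ`.  Seat p34 gen 9,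
file 1: the one-integrand displays `IsRDG` (untranslated: the shape of (5.2.8) with the whole bracket as one integrand) and **`IsDT`**
(translated, with cut-off: the literal shape of line 1 of (5.9.6)); gens 5–8's `IsRD`/`IsRDT` are their cases with the Gaussian factored
out; the passage between them ((5.3.1) for general integrands, both directions); uniqueness; normalization.  Files 2–4 of the seat prove
that the operations of Sects. 5.4, 5.5, 5.8 act on `IsDT` by substitutions in the integrand; file 5 assembles (5.9.6).

statement-level skeleton of published theorems with citation tags; proofs where landed; nothing here is a claim about the Yang–Mills mass gap

PDF held: `paper:balaban1988-cmp114-bij-abelian-higgs-effective-action` (journal page = PDF page + 256); pp. 280–284, 295, 297 [PDF 24–28,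
39, 41] re-read this session (text layer and r16's renders `HOME/lit-balaban-r16/renders/cmp114/original-p0NN-x2.png` as images).
CITATION HEADER (lean-in-tree rule).  Part of the lit-balaban TYPED SKELETON (HOME `run/shared/lean/pub/lit-balaban/`), PHASE-2 proof seat
p34 gen 9 (unit `lit-balaban-p34-g9`; TAKING line HOME/STATUS.md 2026-08-21T21:12:57Z; free-target protocol G.5-34(d), own lineage = the
C1/C2 renormalization-transformation line, gens 5–8: `BIJ88RT51GeneralStep`, `BIJ88RT51Exists`, `BIJ88Eq531Transl*`, `BIJ88RT52Restrictions`,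
`BIJ88Eq528Density`, `BIJ88RT53TranslCut`, `BIJ88RT53DensityForm`).  Rows served: **`C2.Eq5.9.6`** (display shape; owner r16, ROWS-C2-part2:
*"head stays absent until the whole display (5.9.6) is typed"*), support `C2.Eq5.3.1-5.3.7` ((5.3.6) for general integrands).

THE READING (carriers of record; nothing re-declared).  Levels `k` (`u`, `φ`) and `k + 1` (`v`, `ψ`) of `Balaban1983to89.Setup`; `{u^{(j)}}_{j<k}`
= r18's `Prev P k` with `prevMeasure`; `𝒟u` = `fieldMeasure P k U1`, `∫𝒟u δ_{Ax}(u)(·)` = r18's `axialMeasure`; `𝒟φ`, `dψ` = Lebesgue measure; `Q` =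
r18's `qU` ([2] (2.10)); `u·Q^{s*}w` = r18's `surfMul u w`; p31's `cutoff Λ` (`v` on `Λ`, `1` off `Λ`); the translated variable of (5.3.1) with
cut-off `u′_Λ(u) = u·Q^{s*}(cutoff_Λ (Qu)⁻¹)` (gen 7; named `uCut` here) and the block field of the translated display, `v′` on `Λ`, `Qu` off `Λ`
(gen 7's `qU_translCut`; named `vCut`).  THE δ-FUNCTIONS OF LINE 1 OF (5.9.6) IN THE PUSH-FORWARD READING (gen 5's, unchanged): `∫du^{(k)} δ_{Ax}
δ_{Λ′ᶜ}(v/Qu^{(k)}) δ_{Λ′}((e_k/2π)QA^{(k)}) J(u^{(k)}, v)` tested against `g(v)dv` IS `∫ν(du)∫dv′ J(u′_Λ(u), v_Λ(u, v′)) g(v_Λ(u, v′))`, `ν = 𝒟u δ_{Ax}`: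
`u^{(k)} = u′_Λ(u)` runs over the constrained configurations (`Q_Λu′ = 1`, gen 7's `qU_uCut`), the `Λ`-components of `v` are free, the others are
`Qu^{(k)}` (law statement: gen 7's `map_graphCut_eq_prod`).

WHAT IS TYPED / PROVED (theorems unless marked; 0 `sorry`; no `Prop`-valued fact; standard axioms).  §1 `uCut`, `vCut` (defs with bodies) and
their algebra with gen 7's lemmas.  §2 **`IsRDG ν terms Qu G ρ̃`** (def, a predicate on data as gen 8's `IsRD`; `isRD_iff_isRDG` is `Iff.rfl`),
congruence, normalization, uniqueness.  §3 **`IsDT ν terms Λ Qu J ρ̃`** (def) = LINE 1 OF (5.9.6); the iterated integrals are ordered `dv′, ν,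
Π𝒟u^{(j)}, dψ, 𝒟φ` (the order in which the substitutions of Sects. 5.4–5.8 are pointwise operations, files 2–4; immaterial under integrability, companion file);
congruence (the pointwise rewritings of §§5.4–5.9 enter here), normalization, uniqueness.  The passage `IsRDG ↔ IsDT` (the change of variables
(5.3.1)/(5.3.6) for GENERAL integrands) is the companion file `BIJ88Eq596Passage`.  NOT DONE HERE: the substitutions (files 2–4), the assembly
(file 5), the `A`-variables/Jacobian of (5.3.7) (p31), bounds.  Imports gen 8's `BIJ88RT53TranslCut` only.
-/

namespace Literature.MathematicalPhysics.QuantumFieldTheory.BalabanImbrieJaffe1984to88.BIJ88Eq596Display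

open Literature.MathematicalPhysics.QuantumFieldTheory.Balaban1983to89
open BIJ88Sect3Statements (U1)
open BIJ85Sect1Model (HiggsField)
open BIJ88RenormTransf311 (axialMeasure gaussWeight)
open BIJ88InductiveForm41 (Prev prevMeasure)
open BIJ85BlockAveragesTorus (qU surfMul measurable_qU map_surfMul_fieldMeasure qU_surfMul)
open BIJ88Eq536Linearization (cutoff)
open BIJ88Eq531TranslLaw (axialMeasure_map_surfMul surfMul_surfMul surfMul_one measurable_surfMul₂)
open BIJ88Eq531TranslLawCutoff (cutoff_apply qU_translCut qU_uCut uCut_surfMul_cutoff surfMul_uCut_cutoff_qU measurable_uCut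
  measurePreserving_translCut)
open BIJ88RT52Restrictions (Fields fieldsMeasure IsRD integral_fieldsMeasure)
open BIJ88RT53TranslCut (IsRDT)
open BIJ88RT51Unique (ae_eq_of_forall_test integral_test_congr_ae)
open scoped BigOperators ENNReal
open _root_.MeasureTheory _root_.MeasureTheory.Measure Complex Function

noncomputable section

variable {P : Params} {k : ℕ}

/-! ## §1 The translated variables of line 1 of (5.9.6) -/

section Variables

/-- **The translated gauge variable with cut-off**, `u′_Λ(u) = u·Q^{s*}(cutoff_Λ (Qu)⁻¹)` — the variable `u′` of (5.3.1) (`u = u′(Λ₁^{(k)*}Q^{s*}v)`),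
renamed `u^{(k)}` in (5.9.6); its block averages are `1` on `Λ` and those of `u` off `Λ` (gen 7's `qU_uCut`).  Written out by gen 7/8 in every
statement; named here. [cite: BalabanImbrieJaffe1988, (5.3.1) p.280] -/
def uCut (Qu : GaugeField P k U1 → GaugeField P (k+1) U1) (Λ : Finset (PBond P (k+1))) (U : GaugeField P k U1) : GaugeField P k U1 :=
  surfMul U (cutoff Λ fun c => (Qu U c)⁻¹)

/-- **The block gauge field of the translated display**: `v′` on the cut-off `Λ` (the freed components, *"it removes the v-field from the
δ-functions there"*), `Qu` off `Λ` (the surviving `δ_{Λ₁^{(k)′*c}}(v/Qu^{(k)})` of (5.3.6)/(5.9.6)). [cite: BalabanImbrieJaffe1988, (5.3.6) p.280] -/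
def vCut (Qu : GaugeField P k U1 → GaugeField P (k+1) U1) (Λ : Finset (PBond P (k+1))) (U : GaugeField P k U1)
    (v' : GaugeField P (k+1) U1) : GaugeField P (k+1) U1 :=
  fun c => if c ∈ Λ then v' c else Qu U c

/-- kernel: the value of the block field of the translated display. [cite: BalabanImbrieJaffe1988, (5.3.6) p.280] -/
theorem vCut_apply (Qu : GaugeField P k U1 → GaugeField P (k+1) U1) (Λ : Finset (PBond P (k+1))) (U : GaugeField P k U1)
    (v' : GaugeField P (k+1) U1) (c : PBond P (k+1)) : vCut Qu Λ U v' c = if c ∈ Λ then v' c else Qu U c := rfl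

/-- kernel: `uCut` unfolded to gen 7's spelling. [cite: BalabanImbrieJaffe1988, (5.3.1) p.280] -/
theorem uCut_def (Qu : GaugeField P k U1 → GaugeField P (k+1) U1) (Λ : Finset (PBond P (k+1))) (U : GaugeField P k U1) :
    uCut Qu Λ U = surfMul U (cutoff Λ fun c => (Qu U c)⁻¹) := rfl

/-- kernel: the cut-off of the block field of the translated display is the cut-off of its free part. [cite: BalabanImbrieJaffe1988, (5.3.6) p.280] -/
theorem cutoff_vCut (Qu : GaugeField P k U1 → GaugeField P (k+1) U1) (Λ : Finset (PBond P (k+1))) (U : GaugeField P k U1)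
    (v' : GaugeField P (k+1) U1) : cutoff Λ (vCut Qu Λ U v') = cutoff Λ v' := by
  funext c
  by_cases hc : c ∈ Λ <;> simp [cutoff_apply, vCut_apply, hc]

/-- **(5.3.6) in the named variables**: `Q(u′_Λ(u)·Q^{s*}(cutoff_Λ v′)) = v_Λ(u, v′)` (gen 7's `qU_translCut`; standing range).
[cite: BalabanImbrieJaffe1988, (5.3.6) p.280] -/
theorem qU_translCut' (hk : k + 1 ≤ P.m + P.K) (Λ : Finset (PBond P (k+1))) (U : GaugeField P k U1) (v' : GaugeField P (k+1) U1) :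
    qU (surfMul (uCut qU Λ U) (cutoff Λ v')) = vCut qU Λ U v' :=
  qU_translCut hk U v'

/-- kernel: the translated variable is its own translated variable, `(u′_Λ)′_Λ = u′_Λ` (its block averages on `Λ` are `1`: gen 7's `qU_uCut`;
standing range). [cite: BalabanImbrieJaffe1988, (5.3.1) p.280] -/
theorem uCut_uCut (hk : k + 1 ≤ P.m + P.K) (Λ : Finset (PBond P (k+1))) (U : GaugeField P k U1) :
    uCut qU Λ (uCut qU Λ U) = uCut qU Λ U := by
  have h1 : (cutoff Λ fun c => (qU (uCut qU Λ U) c)⁻¹) = fun _ => 1 := by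
    funext c
    rw [uCut_def, qU_uCut hk]
    by_cases hc : c ∈ Λ <;> simp [cutoff_apply, hc]
  conv_lhs => rw [uCut_def, h1, surfMul_one]

/-- kernel: the translated variable of the translated field is the translated variable, `(u′_Λ·Q^{s*}(cutoff_Λ v′))′_Λ = u′_Λ` (gen 7's
`uCut_surfMul_cutoff` and `uCut_uCut`; standing range). [cite: BalabanImbrieJaffe1988, (5.3.1) p.280] -/
theorem uCut_translCut (hk : k + 1 ≤ P.m + P.K) (Λ : Finset (PBond P (k+1))) (U : GaugeField P k U1) (v' : GaugeField P (k+1) U1) :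
    uCut qU Λ (surfMul (uCut qU Λ U) (cutoff Λ v')) = uCut qU Λ U := by
  have h := uCut_surfMul_cutoff (Λ := Λ) hk (uCut qU Λ U) v'
  rw [uCut_def, uCut_def (U := U)]
  rw [uCut_def] at h
  exact h.trans (by rw [← uCut_def, ← uCut_def, uCut_uCut hk])

/-- kernel: `u = u′_Λ(u)·Q^{s*}(cutoff_Λ Qu)` — the translation undone by the own block averages (gen 7's `surfMul_uCut_cutoff_qU`).
[cite: BalabanImbrieJaffe1988, (5.3.1) p.280] -/
theorem translCut_uCut_qU (Λ : Finset (PBond P (k+1))) (U : GaugeField P k U1) :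
    surfMul (uCut qU Λ U) (cutoff Λ (qU U)) = U :=
  surfMul_uCut_cutoff_qU Λ U

/-- kernel: `(u, v′) ↦ v_Λ(u, v′)` is jointly measurable. [cite: BalabanImbrieJaffe1988, (5.3.6) p.280] -/
theorem measurable_vCut₂ (Λ : Finset (PBond P (k+1))) :
    Measurable fun p : GaugeField P k U1 × GaugeField P (k+1) U1 => vCut qU Λ p.1 p.2 := by
  refine measurable_pi_iff.mpr fun c => ?_
  by_cases hc : c ∈ Λ
  · simp only [vCut_apply, if_pos hc]; exact (measurable_pi_apply c).comp measurable_snd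
  · simp only [vCut_apply, if_neg hc]; exact (measurable_pi_apply c).comp (measurable_qU.comp measurable_fst)

end Variables

/-! ## §2 The untranslated display with one integrand -/

section RDG

/-- **The density display of Sect. 5 with ONE integrand** (the shape of (5.2.8) p. 279 with the whole bracket — characteristic functions,
`Πg_k`, `ΠF_{k,loc}`, `ΠZ^{(j)}` and the exponential INCLUDING the `ψ`-Gaussian `exp[−½aL⁻²⟨ψ − Q(u_k)φ, ψ − Q(u_k)φ⟩ − E]` — as one function
`G_t({u^{(j)}}, u, φ, ψ)`), in gen 5's push-forward reading of `∫𝒟u δ(v/Qu)(·)`: for every bounded measurable test function `g`,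
`∫dv dψ ρ̃(v, ψ) g(v, ψ) = Σ_{t∈terms} ∫ν(du) ∫Π_{j<k}𝒟u^{(j)} ∫𝒟φ ∫dψ G_t({u^{(j)}}, u, φ, ψ) g(Qu, ψ)`. [cite: BalabanImbrieJaffe1988, (5.2.8) p.279] -/
def IsRDG {ι : Type*} (ν : Measure (GaugeField P k U1)) (terms : Finset ι) (Qu : GaugeField P k U1 → GaugeField P (k+1) U1)
    (G : ι → Prev P k → GaugeField P k U1 → HiggsField P k → HiggsField P (k+1) → ℂ)
    (ρL : GaugeField P (k+1) U1 → HiggsField P (k+1) → ℂ) : Prop :=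
  ∀ g : GaugeField P (k+1) U1 × HiggsField P (k+1) → ℂ, Measurable g → (∃ C : ℝ, ∀ z, ‖g z‖ ≤ C) →
    ∫ v, ∫ ψ, ρL v ψ * g (v, ψ) ∂volume ∂fieldMeasure P (k+1) U1 =
      ∑ t ∈ terms, ∫ U, ∫ prev, ∫ φ, ∫ ψ, G t prev U φ ψ * g (Qu U, ψ) ∂volume ∂volume ∂prevMeasure P k ∂ν

variable {ι : Type*} {ν : Measure (GaugeField P k U1)} {terms : Finset ι} {Qu : GaugeField P k U1 → GaugeField P (k+1) U1}

/-- **Gen 8's display `IsRD` IS the one-integrand display with `G_t = ρ_t · gaussWeight_a(Q_tφ, ψ)`** (definitionally). [cite: BalabanImbrieJaffe1988, (5.2.8) p.279] -/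
theorem isRD_iff_isRDG (Qφ : ι → Prev P k → GaugeField P k U1 → HiggsField P k → HiggsField P (k+1)) (a : ℝ)
    (ρ : ι → Prev P k → GaugeField P k U1 → HiggsField P k → HiggsField P (k+1) → ℂ) (ρL : GaugeField P (k+1) U1 → HiggsField P (k+1) → ℂ) :
    IsRD ν terms Qu Qφ a ρ ρL ↔ IsRDG ν terms Qu (fun t prev U φ ψ => ρ t prev U φ ψ * (gaussWeight a (Qφ t prev U φ) ψ : ℂ)) ρL :=
  Iff.rfl

/-- Rewriting the integrand pointwise, term by term, does not change the display (the algebraic identities of Sects. 5.4–5.9 between the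
integrands enter (5.9.6) this way). [cite: BalabanImbrieJaffe1988, (5.9.6) p.297] -/
theorem IsRDG.congr {G G' : ι → Prev P k → GaugeField P k U1 → HiggsField P k → HiggsField P (k+1) → ℂ}
    {ρL : GaugeField P (k+1) U1 → HiggsField P (k+1) → ℂ} (h : IsRDG ν terms Qu G ρL)
    (hG : ∀ t ∈ terms, ∀ prev U φ ψ, G' t prev U φ ψ = G t prev U φ ψ) : IsRDG ν terms Qu G' ρL := fun g hg hb => by
  rw [h g hg hb]
  exact Finset.sum_congr rfl fun t ht => by simp only [hG t ht]

/-- Normalization: `∫dv dψ ρ̃ = Σ_t ∫ν(du)∫Π𝒟u^{(j)}∫𝒟φ∫dψ G_t` (test `g ≡ 1`). [cite: BalabanImbrieJaffe1988, (5.2.8) p.279] -/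
theorem integral_eq_of_isRDG {G : ι → Prev P k → GaugeField P k U1 → HiggsField P k → HiggsField P (k+1) → ℂ}
    {ρL : GaugeField P (k+1) U1 → HiggsField P (k+1) → ℂ} (h : IsRDG ν terms Qu G ρL) :
    ∫ v, ∫ ψ, ρL v ψ ∂volume ∂fieldMeasure P (k+1) U1 =
      ∑ t ∈ terms, ∫ U, ∫ prev, ∫ φ, ∫ ψ, G t prev U φ ψ ∂volume ∂volume ∂prevMeasure P k ∂ν := by
  have h1 := h (fun _ => (1 : ℂ)) measurable_const ⟨1, fun _ => by simp⟩
  simp only [mul_one] at h1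
  exact h1

/-- The one-integrand display determines `ρ̃` `dv dψ`-almost everywhere (gen 5's `ae_eq_of_forall_test`). [cite: BalabanImbrieJaffe1988, (5.2.8) p.279] -/
theorem isRDG_unique {G : ι → Prev P k → GaugeField P k U1 → HiggsField P k → HiggsField P (k+1) → ℂ}
    {ρL ρL' : GaugeField P (k+1) U1 → HiggsField P (k+1) → ℂ} (h : IsRDG ν terms Qu G ρL) (h' : IsRDG ν terms Qu G ρL')
    (hi : Integrable (uncurry ρL) ((fieldMeasure P (k+1) U1).prod volume))
    (hi' : Integrable (uncurry ρL') ((fieldMeasure P (k+1) U1).prod volume)) :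
    uncurry ρL =ᵐ[(fieldMeasure P (k+1) U1).prod volume] uncurry ρL' :=
  ae_eq_of_forall_test hi hi' fun g hg hb => by rw [h g hg hb, h' g hg hb]

/-- A `dv dψ`-integrable function a.e. equal to an integrable solution is a solution. [cite: BalabanImbrieJaffe1988, (5.2.8) p.279] -/
theorem isRDG_congr_ae {G : ι → Prev P k → GaugeField P k U1 → HiggsField P k → HiggsField P (k+1) → ℂ}
    {ρL ρL' : GaugeField P (k+1) U1 → HiggsField P (k+1) → ℂ} (h : IsRDG ν terms Qu G ρL)
    (hi : Integrable (uncurry ρL) ((fieldMeasure P (k+1) U1).prod volume))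
    (hi' : Integrable (uncurry ρL') ((fieldMeasure P (k+1) U1).prod volume))
    (hae : uncurry ρL' =ᵐ[(fieldMeasure P (k+1) U1).prod volume] uncurry ρL) : IsRDG ν terms Qu G ρL' := fun g hg hb => by
  rw [integral_test_congr_ae hi hi' hae hg hb]
  exact h g hg hb

end RDG

/-! ## §3 Line 1 of (5.9.6): the translated display with cut-off and one integrand -/

section DT

/-- **LINE 1 OF (5.9.6)** p. 297 [PDF 41] — *"ρ^L_{k+1}(v, ψ) = Σ_{{X_ω}} Σ_{Λ₀^{(k)}} ∫du^{(k)}dφ^{(k)} δ_{Ax}(u^{(k)}) δ_{Λ₁^{(k)′*c}}(v/Qu^{(k)})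
δ_{Λ₁^{(k)′*}}((e_k/2π)QA^{(k)}) ∫Π_{j=0}^{k−1}du^{(j)}|_{Λ₁₀^{(j)c*} [ … ]"* — at measure level, for a general integrand `J_t({u^{(j)}}, u^{(k)}, v, φ^{(k)}, ψ)`
(the bracket; a function of the translated gauge field `u^{(k)}` AND of `v`): `ρ̃ = ρ^L_{k+1}` is a `(v, ψ)`-density w.r.t. `dv dψ` such that for every
bounded measurable test function `g`, `∫dv dψ ρ̃ g = Σ_{t∈terms} ∫dv′ ∫ν(du) ∫Π𝒟u^{(j)} ∫dψ ∫𝒟φ J_t({u^{(j)}}, u′_{Λ_t}(u), v_{Λ_t}(u, v′), φ, ψ) · g(v_{Λ_t}(u, v′), ψ)`: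
`u^{(k)} = u′_Λ(u)` ranges over the constrained configurations (`∫du^{(k)}δ_{Ax}δ_{Λ′}(QA^{(k)})` = the law of `uCut` under `ν = 𝒟u δ_{Ax}`), the
`Λ_t`-components of `v` are free (`dv′`), the others are `Qu^{(k)}` (`δ_{Λ′ᶜ}(v/Qu^{(k)})`).  DATA: the `u`-law `ν`, the finite family `terms`
(`{X_ω}` and `Λ₀^{(k)}`), the cut-offs `Λ_t = Λ₁^{(k)′*}` of the terms, the block average `Qu`, the integrands `J_t`.  The iterated integrals are
ordered `dv′, ν, Π𝒟u^{(j)}, dψ, 𝒟φ` (the order in which the substitutions of Sects. 5.4–5.8 are pointwise operations; immaterial under integrability,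
`BIJ88Eq596Passage`). [cite: BalabanImbrieJaffe1988, (5.9.6) p.297] -/
def IsDT {ι : Type*} (ν : Measure (GaugeField P k U1)) (terms : Finset ι) (Λ : ι → Finset (PBond P (k+1)))
    (Qu : GaugeField P k U1 → GaugeField P (k+1) U1)
    (J : ι → Prev P k → GaugeField P k U1 → GaugeField P (k+1) U1 → HiggsField P k → HiggsField P (k+1) → ℂ)
    (ρL : GaugeField P (k+1) U1 → HiggsField P (k+1) → ℂ) : Prop :=
  ∀ g : GaugeField P (k+1) U1 × HiggsField P (k+1) → ℂ, Measurable g → (∃ C : ℝ, ∀ z, ‖g z‖ ≤ C) →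
    ∫ v, ∫ ψ, ρL v ψ * g (v, ψ) ∂volume ∂fieldMeasure P (k+1) U1 =
      ∑ t ∈ terms, ∫ v', ∫ U, ∫ prev, ∫ ψ, ∫ φ,
        J t prev (uCut Qu (Λ t) U) (vCut Qu (Λ t) U v') φ ψ * g (vCut Qu (Λ t) U v', ψ)
        ∂volume ∂volume ∂prevMeasure P k ∂ν ∂fieldMeasure P (k+1) U1

variable {ι : Type*} {ν : Measure (GaugeField P k U1)} {terms : Finset ι} {Λ : ι → Finset (PBond P (k+1))}
variable {Qu : GaugeField P k U1 → GaugeField P (k+1) U1}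
variable {J J' : ι → Prev P k → GaugeField P k U1 → GaugeField P (k+1) U1 → HiggsField P k → HiggsField P (k+1) → ℂ}
variable {ρL ρL' : GaugeField P (k+1) U1 → HiggsField P (k+1) → ℂ}

/-- **Rewriting the bracket pointwise does not change the display** — the algebraic *"concluding formulae in the last several sections"*
((5.4.3)–(5.4.10), (5.5.3)–(5.5.14), (5.6.6)–(5.6.13), (5.7.13), (5.8.2)–(5.8.3)) and the insertions of characteristic functions of Sect. 5.9
*"without changing anything"* enter (5.9.6) as pointwise identities between integrands, at every point of the configuration space the
display integrates over. [cite: BalabanImbrieJaffe1988, (5.9.6) p.297] -/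
theorem IsDT.congr (h : IsDT ν terms Λ Qu J ρL)
    (hJ : ∀ t ∈ terms, ∀ prev U v' φ ψ, J' t prev (uCut Qu (Λ t) U) (vCut Qu (Λ t) U v') φ ψ = J t prev (uCut Qu (Λ t) U) (vCut Qu (Λ t) U v') φ ψ) :
    IsDT ν terms Λ Qu J' ρL := fun g hg hb => by
  rw [h g hg hb]
  exact Finset.sum_congr rfl fun t ht => by simp only [hJ t ht]

/-- The same with the identity assumed at every argument (not only on the translated configurations). [cite: BalabanImbrieJaffe1988, (5.9.6) p.297] -/
theorem IsDT.congr' (h : IsDT ν terms Λ Qu J ρL) (hJ : ∀ t ∈ terms, ∀ prev u' v φ ψ, J' t prev u' v φ ψ = J t prev u' v φ ψ) :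
    IsDT ν terms Λ Qu J' ρL :=
  h.congr fun t ht prev _ _ φ ψ => hJ t ht prev _ _ φ ψ

/-- Normalization of the translated display (test `g ≡ 1`): `∫dv dψ ρ̃ = Σ_t ∫dv′∫ν∫Π𝒟u^{(j)}∫dψ∫𝒟φ J_t(…)`. [cite: BalabanImbrieJaffe1988, (5.9.6) p.297] -/
theorem integral_eq_of_isDT (h : IsDT ν terms Λ Qu J ρL) :
    ∫ v, ∫ ψ, ρL v ψ ∂volume ∂fieldMeasure P (k+1) U1 =
      ∑ t ∈ terms, ∫ v', ∫ U, ∫ prev, ∫ ψ, ∫ φ, J t prev (uCut Qu (Λ t) U) (vCut Qu (Λ t) U v') φ ψ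
        ∂volume ∂volume ∂prevMeasure P k ∂ν ∂fieldMeasure P (k+1) U1 := by
  have h1 := h (fun _ => (1 : ℂ)) measurable_const ⟨1, fun _ => by simp⟩
  simp only [mul_one] at h1
  exact h1

/-- **Line 1 of (5.9.6) determines `ρ^L_{k+1}` `dv dψ`-almost everywhere**: two `dv dψ`-integrable densities satisfying the translated display for
the same data agree a.e. [cite: BalabanImbrieJaffe1988, (5.9.6) p.297] -/
theorem isDT_unique (h : IsDT ν terms Λ Qu J ρL) (h' : IsDT ν terms Λ Qu J ρL')
    (hi : Integrable (uncurry ρL) ((fieldMeasure P (k+1) U1).prod volume))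
    (hi' : Integrable (uncurry ρL') ((fieldMeasure P (k+1) U1).prod volume)) :
    uncurry ρL =ᵐ[(fieldMeasure P (k+1) U1).prod volume] uncurry ρL' :=
  ae_eq_of_forall_test hi hi' fun g hg hb => by rw [h g hg hb, h' g hg hb]

/-- A `dv dψ`-integrable function a.e. equal to an integrable solution of the translated display is a solution. [cite: BalabanImbrieJaffe1988, (5.9.6) p.297] -/
theorem isDT_congr_ae (h : IsDT ν terms Λ Qu J ρL)
    (hi : Integrable (uncurry ρL) ((fieldMeasure P (k+1) U1).prod volume))
    (hi' : Integrable (uncurry ρL') ((fieldMeasure P (k+1) U1).prod volume))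
    (hae : uncurry ρL' =ᵐ[(fieldMeasure P (k+1) U1).prod volume] uncurry ρL) : IsDT ν terms Λ Qu J ρL' := fun g hg hb => by
  rw [integral_test_congr_ae hi hi' hae hg hb]
  exact h g hg hb

end DT


end

end Literature.MathematicalPhysics.QuantumFieldTheory.BalabanImbrieJaffe1984to88.BIJ88Eq596Display
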